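import Summits.RiemannHypothesis.RiemannHypothesis.Theorems.JensenPolynomialsSkewFarBulk

/-!
# Route `JensenPolynomials`, FAR crux `XiCumulantSkew98Far` — part 3: the four Stein equations with error terms
(RH-FREE; cell rh-jensen, HUMAN RULING D-0040)

Notation (all for `s ≥ 4·10¹⁸`, `a = a_s = xiMode s`, `t = u − a`, weight `Φu^s` on `(0, ∞)`): `I_n = ∫ Φu^s t^n`
(`I_{2i} = xiAbsMoment s (2i) a`, `I_0 = Z = xiMoment s`), `A = 4πe^{4a}`, `R = 4A + s/a²`, `c = 8A − s/a³`,
`C₃ = 15A + 2s/a⁴`, `θ = 1/200`, `K = 10⁸`, and a free scale `l > 0` (later `l = a/√s`).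
Combining the Stein identity `j·I_{j−1} = ∫ Φu^s t^j W′` (part 1) with the global quadratic model of `W′` (part 2),
the pointwise AM–GM splits `|t| ≤ (l + t²/l)/2` and the sign fact `t·W′ ≥ 0`, we get the STEIN SYSTEM WITH ERRORS

* `|R I₁ + c I₂| ≤ θZ + (C₃/2)(l I₂ + I₄/l) + (K/2)(3l I₂ + 5I₄/l) + (KR/2)(l I₄ + I₆/l) + Kc I₆`      (`sys0`)
* `|Z − R I₂ − c I₃| ≤ (θ/2)(lZ + I₂/l) + C₃I₄ + 5K I₄ + KR I₆ + (Kc/2)(l I₆ + I₈/l)`                (`sys1`)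
* `|2I₁ − R I₃ − c I₄| ≤ θI₂ + (C₃/2)(l I₄ + I₆/l) + (K/2)(5l I₄ + 7I₆/l) + (KR/2)(l I₆ + I₈/l) + Kc I₈` (`sys2`)
* `|3I₂ − R I₄ − c I₅| ≤ (θ/2)(l I₂ + I₄/l) + C₃I₆ + 7K I₆ + KR I₈ + (Kc/2)(l I₈ + I₁₀/l)`              (`sys3`)

together with the AM–GM bounds `|I₁| ≤ (lZ + I₂/l)/2`, `|I₃| ≤ (lI₂ + I₄/l)/2`, `|I₅| ≤ (lI₄ + I₆/l)/2`
(`absOddMoment_le`). Part 4 inserts `I_{2i} ≤ (2i−1)‼(a²/s)^i Z` and solves for `I₁, …, I₄`.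
WHAT THIS IS NOT: nothing here bears on the zeros of `ζ`. References: Stein's method / IBP (folklore); [CoffeyCsordas2013].
-/

noncomputable section
-- D-0017: `Summit.RiemannHypothesis.RiemannHypothesis.…` duplicates the namespace BY DESIGN (single-problem summit).
set_option linter.dupNamespace false

namespace Summit.RiemannHypothesis.RiemannHypothesis.Theorems.JensenPolynomials.SkewFar

open Literature.NumberTheory.LFunctions Literature.Probability.Distributions MeasureTheory Set Filter Real
open scoped Topology Nat

/-! ## 1. Pointwise inequalities (pure real arithmetic) -/

/-- AM–GM split of `|t|`: `|t| ≤ (l + t²/l)/2` for `l > 0`. -/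
theorem abs_le_amgm {l : ℝ} (hl : 0 < l) (t : ℝ) : |t| ≤ (l + t ^ 2 / l) / 2 := by
  have h : 0 ≤ (l - |t|) ^ 2 := sq_nonneg _
  have e : (l + t ^ 2 / l) / 2 - |t| = (l - |t|) ^ 2 / (2 * l) := by
    rw [← sq_abs t]; field_simp; ring
  have : 0 ≤ (l + t ^ 2 / l) / 2 - |t| := by rw [e]; positivity
  linarith

/-- `|t|³ ≤ (l t² + t⁴/l)/2`. -/
theorem abs_pow_three_le {l : ℝ} (hl : 0 < l) (t : ℝ) : |t| ^ 3 ≤ (l * t ^ 2 + t ^ 4 / l) / 2 := by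
  have h := abs_le_amgm hl t
  have e : |t| ^ 3 = t ^ 2 * |t| := by rw [pow_succ, sq_abs]
  rw [e]
  calc t ^ 2 * |t| ≤ t ^ 2 * ((l + t ^ 2 / l) / 2) := mul_le_mul_of_nonneg_left h (sq_nonneg t)
    _ = (l * t ^ 2 + t ^ 4 / l) / 2 := by ring

/-- `t^{2i}·|t| ≤ (l t^{2i} + t^{2i+2}/l)/2`, stated for a nonnegative factor `p = t^{2i}`. -/
theorem mul_abs_le {l : ℝ} (hl : 0 < l) (t : ℝ) {p : ℝ} (hp : 0 ≤ p) :
    p * |t| ≤ (l * p + p * t ^ 2 / l) / 2 := by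
  have h := abs_le_amgm hl t
  calc p * |t| ≤ p * ((l + t ^ 2 / l) / 2) := mul_le_mul_of_nonneg_left h hp
    _ = (l * p + p * t ^ 2 / l) / 2 := by ring

/-- Pointwise bound, `k = 0`: from `|ρ| ≤ θ + C|t|³ + Kt⁴(|w| + R|t| + ct²)` and `tw ≥ 0`. -/
theorem pw0 {θ C K R c l t w ρ : ℝ} (hl : 0 < l) (hK : 0 ≤ K) (hR : 0 ≤ R) (hC : 0 ≤ C)
    (htw : 0 ≤ t * w) (hρ : |ρ| ≤ θ + C * |t| ^ 3 + K * t ^ 4 * (|w| + R * |t| + c * t ^ 2)) :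
    |ρ| ≤ θ + C / 2 * (l * t ^ 2 + t ^ 4 / l) + K / 2 * (l * (t ^ 3 * w) + t ^ 5 * w / l) +
      K * R / 2 * (l * t ^ 4 + t ^ 6 / l) + K * c * t ^ 6 := by
  have h3 := abs_pow_three_le hl t
  have htw' : |t| * |w| = t * w := by rw [← abs_mul, abs_of_nonneg htw]
  -- `t⁴|w| = |t|³ (tw)` and `|t|³ ≤ …`
  have e1 : t ^ 4 * |w| = |t| ^ 3 * (t * w) := by
    rw [← htw']
    have : t ^ 4 = |t| ^ 4 := by rw [← abs_pow, abs_of_nonneg (by positivity)]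
    rw [this]; ring
  have h4w : t ^ 4 * |w| ≤ (l * t ^ 2 + t ^ 4 / l) / 2 * (t * w) := by
    rw [e1]; exact mul_le_mul_of_nonneg_right h3 htw
  -- `t⁴|t| ≤ …`
  have h5 : t ^ 4 * |t| ≤ (l * t ^ 4 + t ^ 4 * t ^ 2 / l) / 2 := mul_abs_le hl t (by positivity)
  have hsum : K * t ^ 4 * (|w| + R * |t| + c * t ^ 2) =
      K * (t ^ 4 * |w|) + K * R * (t ^ 4 * |t|) + K * c * t ^ 6 := by ring
  rw [hsum] at hρ
  have i1 := mul_le_mul_of_nonneg_left h3 hC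
  have i2 := mul_le_mul_of_nonneg_left h4w hK
  have i3 := mul_le_mul_of_nonneg_left h5 (mul_nonneg hK hR)
  have e2 : K * ((l * t ^ 2 + t ^ 4 / l) / 2 * (t * w)) = K / 2 * (l * (t ^ 3 * w) + t ^ 5 * w / l) := by ring
  have e3 : K * R * ((l * t ^ 4 + t ^ 4 * t ^ 2 / l) / 2) = K * R / 2 * (l * t ^ 4 + t ^ 6 / l) := by ring
  linarith

/-- Pointwise bound, `k = 1`. -/
theorem pw1 {θ C K R c l t w ρ : ℝ} (hl : 0 < l) (hθ : 0 ≤ θ) (hK : 0 ≤ K) (hc : 0 ≤ c)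
    (htw : 0 ≤ t * w) (hρ : |ρ| ≤ θ + C * |t| ^ 3 + K * t ^ 4 * (|w| + R * |t| + c * t ^ 2)) :
    |t * ρ| ≤ θ / 2 * (l + t ^ 2 / l) + C * t ^ 4 + K * (t ^ 5 * w) + K * R * t ^ 6 +
      K * c / 2 * (l * t ^ 6 + t ^ 8 / l) := by
  have h1 := abs_le_amgm hl t
  have htw' : |t| * |w| = t * w := by rw [← abs_mul, abs_of_nonneg htw]
  have ht0 := abs_nonneg t
  rw [abs_mul]
  have hmul := mul_le_mul_of_nonneg_left hρ ht0
  have e1 : |t| * (θ + C * |t| ^ 3 + K * t ^ 4 * (|w| + R * |t| + c * t ^ 2)) =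
      θ * |t| + C * (|t| ^ 4) + K * t ^ 4 * (|t| * |w|) + K * R * t ^ 4 * |t| ^ 2 + K * c * (t ^ 6 * |t|) := by ring
  rw [e1, htw'] at hmul
  have e4 : |t| ^ 4 = t ^ 4 := by rw [← abs_pow, abs_of_nonneg (by positivity)]
  have e2 : |t| ^ 2 = t ^ 2 := sq_abs t
  rw [e4, e2] at hmul
  have h7 : t ^ 6 * |t| ≤ (l * t ^ 6 + t ^ 6 * t ^ 2 / l) / 2 := mul_abs_le hl t (by positivity)
  have i1 := mul_le_mul_of_nonneg_left h1 hθ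
  have i2 := mul_le_mul_of_nonneg_left h7 (mul_nonneg hK hc)
  have e3 : K * c * ((l * t ^ 6 + t ^ 6 * t ^ 2 / l) / 2) = K * c / 2 * (l * t ^ 6 + t ^ 8 / l) := by ring
  have e5 : K * t ^ 4 * (t * w) = K * (t ^ 5 * w) := by ring
  have e6 : K * R * t ^ 4 * t ^ 2 = K * R * t ^ 6 := by ring
  linarith

/-- Pointwise bound, `k = 2`. -/
theorem pw2 {θ C K R c l t w ρ : ℝ} (hl : 0 < l) (hK : 0 ≤ K) (hR : 0 ≤ R) (hC : 0 ≤ C)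
    (htw : 0 ≤ t * w) (hρ : |ρ| ≤ θ + C * |t| ^ 3 + K * t ^ 4 * (|w| + R * |t| + c * t ^ 2)) :
    |t ^ 2 * ρ| ≤ θ * t ^ 2 + C / 2 * (l * t ^ 4 + t ^ 6 / l) + K / 2 * (l * (t ^ 5 * w) + t ^ 7 * w / l) +
      K * R / 2 * (l * t ^ 6 + t ^ 8 / l) + K * c * t ^ 8 := by
  have h0 := pw0 hl hK hR hC htw hρ
  have ht2 : 0 ≤ t ^ 2 := sq_nonneg t
  rw [abs_mul, abs_of_nonneg ht2]
  have h := mul_le_mul_of_nonneg_left h0 ht2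
  have e : t ^ 2 * (θ + C / 2 * (l * t ^ 2 + t ^ 4 / l) + K / 2 * (l * (t ^ 3 * w) + t ^ 5 * w / l) +
      K * R / 2 * (l * t ^ 4 + t ^ 6 / l) + K * c * t ^ 6) =
      θ * t ^ 2 + C / 2 * (l * t ^ 4 + t ^ 6 / l) + K / 2 * (l * (t ^ 5 * w) + t ^ 7 * w / l) +
      K * R / 2 * (l * t ^ 6 + t ^ 8 / l) + K * c * t ^ 8 := by ring
  linarith

/-- Pointwise bound, `k = 3`. -/
theorem pw3 {θ C K R c l t w ρ : ℝ} (hl : 0 < l) (hθ : 0 ≤ θ) (hK : 0 ≤ K) (hc : 0 ≤ c)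
    (htw : 0 ≤ t * w) (hρ : |ρ| ≤ θ + C * |t| ^ 3 + K * t ^ 4 * (|w| + R * |t| + c * t ^ 2)) :
    |t ^ 3 * ρ| ≤ θ / 2 * (l * t ^ 2 + t ^ 4 / l) + C * t ^ 6 + K * (t ^ 7 * w) + K * R * t ^ 8 +
      K * c / 2 * (l * t ^ 8 + t ^ 10 / l) := by
  have h1 := pw1 hl hθ hK hc htw hρ
  have ht2 : 0 ≤ t ^ 2 := sq_nonneg t
  have e0 : |t ^ 3 * ρ| = t ^ 2 * |t * ρ| := by
    rw [show t ^ 3 * ρ = t ^ 2 * (t * ρ) by ring, abs_mul, abs_of_nonneg ht2]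
  rw [e0]
  have h := mul_le_mul_of_nonneg_left h1 ht2
  have e : t ^ 2 * (θ / 2 * (l + t ^ 2 / l) + C * t ^ 4 + K * (t ^ 5 * w) + K * R * t ^ 6 +
      K * c / 2 * (l * t ^ 6 + t ^ 8 / l)) =
      θ / 2 * (l * t ^ 2 + t ^ 4 / l) + C * t ^ 6 + K * (t ^ 7 * w) + K * R * t ^ 8 +
      K * c / 2 * (l * t ^ 8 + t ^ 10 / l) := by ring
  linarith


/-! ## 2. Integrability and linear-combination helpers -/

/-- `Φu^s (u−a)^j W_s′(u)` is integrable on `(0, ∞)` (`s ≥ 1`). -/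
theorem integrableOn_tilt_pow_W (s j : ℕ) (hs : 1 ≤ s) (a : ℝ) :
    IntegrableOn (fun u : ℝ => deBruijnPhi u * u ^ s * ((u - a) ^ j * xiPotentialDeriv s u)) (Ioi 0) := by
  have hA := (integrableOn_subPow_mul_pow_mul_deBruijnPhiDeriv s j a).neg
  have hB := (integrableOn_deBruijnPhi_mul_pow_mul_sub_pow (s - 1) j a).const_mul (s : ℝ)
  refine IntegrableOn.congr_fun (hA.sub hB) (fun u hu => ?_) measurableSet_Ioi
  rw [stein_integrand_eq s j hs a hu]
  simp only [Pi.neg_apply, Pi.sub_apply]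
  ring

/-- `xiAbsMoment s (2i) a = ∫ Φu^s (u − a)^{2i}` (even absolute moments are plain moments). -/
theorem xiAbsMoment_even (s i : ℕ) (a : ℝ) :
    xiAbsMoment s (2 * i) a = ∫ u in Ioi 0, deBruijnPhi u * u ^ s * (u - a) ^ (2 * i) := by
  unfold xiAbsMoment
  refine setIntegral_congr_fun measurableSet_Ioi fun u _ => ?_
  rw [pow_abs_two_mul]

/-- `xiAbsMoment s 0 a = M_s`. -/
theorem xiAbsMoment_zero' (s : ℕ) (a : ℝ) : xiAbsMoment s 0 a = xiMoment s := by
  unfold xiAbsMoment xiMoment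
  refine setIntegral_congr_fun measurableSet_Ioi fun u _ => ?_
  rw [pow_zero, mul_one]

/-- The a-priori bound of part 1 in `xiAbsMoment` form: `xiAbsMoment s (2n) a_s ≤ (2n−1)‼ (a_s²/s)^n M_s`. -/
theorem xiAbsMoment_even_le (s : ℕ) (hs : 4 * 10 ^ 18 ≤ s) (n : ℕ) :
    xiAbsMoment s (2 * n) (xiMode (s : ℝ)) ≤ ((2 * n - 1)‼ : ℝ) * (xiMode (s : ℝ) ^ 2 / s) ^ n * xiMoment s := by
  have hs1 : 1 ≤ s := le_trans (by norm_num) hs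
  have ha := (mode_facts s hs).2.1
  rw [xiAbsMoment_even]
  exact evenMoment_le s hs1 (by linarith) n

/-- Linear combination of even moments: `∫ Φu^s (α₀ + α₁t² + α₂t⁴ + α₃t⁶ + α₄t⁸ + α₅t¹⁰)`. -/
theorem integral_evenPoly (s : ℕ) (a α₀ α₁ α₂ α₃ α₄ α₅ : ℝ) :
    ∫ u in Ioi 0, deBruijnPhi u * u ^ s * (α₀ + α₁ * (u - a) ^ 2 + α₂ * (u - a) ^ 4 + α₃ * (u - a) ^ 6 +
        α₄ * (u - a) ^ 8 + α₅ * (u - a) ^ 10) =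
      α₀ * xiMoment s + α₁ * xiAbsMoment s 2 a + α₂ * xiAbsMoment s 4 a + α₃ * xiAbsMoment s 6 a +
        α₄ * xiAbsMoment s 8 a + α₅ * xiAbsMoment s 10 a := by
  have hI := fun n => integrableOn_deBruijnPhi_mul_pow_mul_sub_pow s n a
  rw [show (2 : ℕ) = 2 * 1 from rfl, show (4 : ℕ) = 2 * 2 from rfl, show (6 : ℕ) = 2 * 3 from rfl,
    show (8 : ℕ) = 2 * 4 from rfl, show (10 : ℕ) = 2 * 5 from rfl]
  simp only [xiAbsMoment_even, xiMoment]
  have e : ∀ u : ℝ, deBruijnPhi u * u ^ s * (α₀ + α₁ * (u - a) ^ (2 * 1) + α₂ * (u - a) ^ (2 * 2) +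
      α₃ * (u - a) ^ (2 * 3) + α₄ * (u - a) ^ (2 * 4) + α₅ * (u - a) ^ (2 * 5)) =
      α₀ * (deBruijnPhi u * u ^ s * (u - a) ^ 0) + α₁ * (deBruijnPhi u * u ^ s * (u - a) ^ (2 * 1)) +
      α₂ * (deBruijnPhi u * u ^ s * (u - a) ^ (2 * 2)) + α₃ * (deBruijnPhi u * u ^ s * (u - a) ^ (2 * 3)) +
      α₄ * (deBruijnPhi u * u ^ s * (u - a) ^ (2 * 4)) + α₅ * (deBruijnPhi u * u ^ s * (u - a) ^ (2 * 5)) := by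
    intro u; ring
  simp_rw [e]
  rw [integral_add, integral_add, integral_add, integral_add, integral_add, integral_const_mul, integral_const_mul,
    integral_const_mul, integral_const_mul, integral_const_mul, integral_const_mul]
  · simp only [pow_zero, mul_one]
  all_goals first
    | exact (hI _).const_mul _
    | exact ((hI _).const_mul _).add ((hI _).const_mul _)
    | exact (((hI _).const_mul _).add ((hI _).const_mul _)).add ((hI _).const_mul _)
    | exact ((((hI _).const_mul _).add ((hI _).const_mul _)).add ((hI _).const_mul _)).add ((hI _).const_mul _)
    | exact (((((hI _).const_mul _).add ((hI _).const_mul _)).add ((hI _).const_mul _)).add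
        ((hI _).const_mul _)).add ((hI _).const_mul _)

/-- Linear combination of two Stein values: `∫ Φu^s (β₁t^{2i+1} + β₂t^{2i+3}) W′ = β₁(2i+1)I_{2i} + β₂(2i+3)I_{2i+2}`. -/
theorem integral_W_pair (s : ℕ) (hs : 1 ≤ s) (a β₁ β₂ : ℝ) (i : ℕ) :
    ∫ u in Ioi 0, deBruijnPhi u * u ^ s * ((β₁ * (u - a) ^ (2 * i + 1) + β₂ * (u - a) ^ (2 * i + 3)) *
        xiPotentialDeriv s u) =
      β₁ * ((2 * i + 1 : ℝ) * xiAbsMoment s (2 * i) a) + β₂ * ((2 * i + 3 : ℝ) * xiAbsMoment s (2 * i + 2) a) := by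
  have h1 := stein s (2 * i + 1) hs a
  have h2 := stein s (2 * i + 3) hs a
  rw [show 2 * i + 1 - 1 = 2 * i by omega] at h1
  rw [show 2 * i + 3 - 1 = 2 * (i + 1) by omega] at h2
  have e1 : ((2 * i + 1 : ℕ) : ℝ) = 2 * i + 1 := by push_cast; ring
  have e2 : ((2 * i + 3 : ℕ) : ℝ) = 2 * i + 3 := by push_cast; ring
  rw [e1] at h1
  rw [e2] at h2
  rw [show 2 * i + 2 = 2 * (i + 1) by ring, xiAbsMoment_even, xiAbsMoment_even, h1, h2]
  have hA := integrableOn_tilt_pow_W s (2 * i + 1) hs a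
  have hB := integrableOn_tilt_pow_W s (2 * i + 3) hs a
  rw [← integral_const_mul, ← integral_const_mul, ← integral_add (hA.const_mul _) (hB.const_mul _)]
  refine setIntegral_congr_fun measurableSet_Ioi fun u _ => ?_
  ring

/-! ## 3. The Stein system with errors -/

/-- Common pointwise inputs at a point `u > 0`: `t·W′ ≥ 0` and the global model bound (part 2). -/
theorem pointwise_inputs (s : ℕ) (hs : 4 * 10 ^ 18 ≤ s) {A R c : ℝ} (hA : A = 4 * π * exp (4 * xiMode (s : ℝ)))
    (hR : R = 4 * A + s / xiMode (s : ℝ) ^ 2) (hc : c = 8 * A - s / xiMode (s : ℝ) ^ 3) {u : ℝ} (hu : 0 < u) :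
    0 ≤ (u - xiMode (s : ℝ)) * xiPotentialDeriv s u ∧
    |xiPotentialDeriv s u - R * (u - xiMode (s : ℝ)) - c * (u - xiMode (s : ℝ)) ^ 2| ≤
      1 / 200 + (15 * A + 2 * s / xiMode (s : ℝ) ^ 4) * |u - xiMode (s : ℝ)| ^ 3 +
        10 ^ 8 * (u - xiMode (s : ℝ)) ^ 4 *
          (|xiPotentialDeriv s u| + R * |u - xiMode (s : ℝ)| + c * (u - xiMode (s : ℝ)) ^ 2) := by
  have hs1 : 1 ≤ s := le_trans (by norm_num) hs
  have ha := (mode_facts s hs).2.1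
  refine ⟨?_, global_bound s hs hA hR hc u⟩
  have h := sub_mul_xiPotentialDeriv_ge s hs1 (by linarith) hu
  have : 0 ≤ (s : ℝ) / xiMode (s : ℝ) ^ 2 * (u - xiMode (s : ℝ)) ^ 2 := by positivity
  linarith

/-- **Generic integration step.** If `|Φu^s (u−a)^k ρ̃(u)|` (`ρ̃ = W′ − R t − c t²`) is dominated on `(0, ∞)` by
`Φu^s·(α₀ + α₁t² + ⋯ + α₅t¹⁰) + Φu^s·(β₁t^{2i+1} + β₂t^{2i+3})W′`, then
`|k·I_{k−1} − R I_{k+1} − c I_{k+2}| ≤ α₀Z + α₁I₂ + ⋯ + α₅I₁₀ + β₁(2i+1)I_{2i} + β₂(2i+3)I_{2i+2}`. -/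
theorem sys_of_pointwise (s : ℕ) (hs1 : 1 ≤ s) (a R c : ℝ) (k i : ℕ) (α₀ α₁ α₂ α₃ α₄ α₅ β₁ β₂ : ℝ)
    (hpw : ∀ u ∈ Ioi (0 : ℝ),
      |deBruijnPhi u * u ^ s * ((u - a) ^ k * (xiPotentialDeriv s u - R * (u - a) - c * (u - a) ^ 2))| ≤
        deBruijnPhi u * u ^ s * (α₀ + α₁ * (u - a) ^ 2 + α₂ * (u - a) ^ 4 + α₃ * (u - a) ^ 6 +
          α₄ * (u - a) ^ 8 + α₅ * (u - a) ^ 10) +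
        deBruijnPhi u * u ^ s * ((β₁ * (u - a) ^ (2 * i + 1) + β₂ * (u - a) ^ (2 * i + 3)) *
          xiPotentialDeriv s u)) :
    |(k : ℝ) * (∫ u in Ioi 0, deBruijnPhi u * u ^ s * (u - a) ^ (k - 1)) -
        R * (∫ u in Ioi 0, deBruijnPhi u * u ^ s * (u - a) ^ (k + 1)) -
        c * (∫ u in Ioi 0, deBruijnPhi u * u ^ s * (u - a) ^ (k + 2))| ≤
      α₀ * xiMoment s + α₁ * xiAbsMoment s 2 a + α₂ * xiAbsMoment s 4 a + α₃ * xiAbsMoment s 6 a +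
        α₄ * xiAbsMoment s 8 a + α₅ * xiAbsMoment s 10 a +
        (β₁ * ((2 * i + 1 : ℝ) * xiAbsMoment s (2 * i) a) + β₂ * ((2 * i + 3 : ℝ) * xiAbsMoment s (2 * i + 2) a)) := by
  have hW := integrableOn_tilt_pow_W s k hs1 a
  have hI := fun n => integrableOn_deBruijnPhi_mul_pow_mul_sub_pow s n a
  have hst := stein s k hs1 a
  set F : ℝ → ℝ := fun u => deBruijnPhi u * u ^ s *
    ((u - a) ^ k * (xiPotentialDeriv s u - R * (u - a) - c * (u - a) ^ 2)) with hF
  have hFval : ∫ u in Ioi 0, F u = (k : ℝ) * (∫ u in Ioi 0, deBruijnPhi u * u ^ s * (u - a) ^ (k - 1)) -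
      R * (∫ u in Ioi 0, deBruijnPhi u * u ^ s * (u - a) ^ (k + 1)) -
      c * (∫ u in Ioi 0, deBruijnPhi u * u ^ s * (u - a) ^ (k + 2)) := by
    have e : ∀ u, F u = deBruijnPhi u * u ^ s * ((u - a) ^ k * xiPotentialDeriv s u) -
        R * (deBruijnPhi u * u ^ s * (u - a) ^ (k + 1)) - c * (deBruijnPhi u * u ^ s * (u - a) ^ (k + 2)) := by
      intro u; simp only [hF]; ring
    simp_rw [e]
    rw [integral_sub, integral_sub, integral_const_mul, integral_const_mul, ← hst]
    · exact hW
    · exact (hI _).const_mul R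
    · exact hW.sub ((hI _).const_mul R)
    · exact (hI _).const_mul c
  have h1 : IntegrableOn (fun u => deBruijnPhi u * u ^ s *
      (α₀ + α₁ * (u - a) ^ 2 + α₂ * (u - a) ^ 4 + α₃ * (u - a) ^ 6 + α₄ * (u - a) ^ 8 + α₅ * (u - a) ^ 10))
      (Ioi 0) := by
    have h := ((((((hI 0).const_mul α₀).add ((hI 2).const_mul α₁)).add ((hI 4).const_mul α₂)).add
      ((hI 6).const_mul α₃)).add ((hI 8).const_mul α₄)).add ((hI 10).const_mul α₅)
    refine IntegrableOn.congr_fun h (fun u _ => ?_) measurableSet_Ioi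
    simp only [Pi.add_apply, pow_zero, mul_one]
    ring
  have h2 : IntegrableOn (fun u => deBruijnPhi u * u ^ s *
      ((β₁ * (u - a) ^ (2 * i + 1) + β₂ * (u - a) ^ (2 * i + 3)) * xiPotentialDeriv s u)) (Ioi 0) := by
    have h := ((integrableOn_tilt_pow_W s (2 * i + 1) hs1 a).const_mul β₁).add
      ((integrableOn_tilt_pow_W s (2 * i + 3) hs1 a).const_mul β₂)
    refine IntegrableOn.congr_fun h (fun u _ => ?_) measurableSet_Ioi
    simp only [Pi.add_apply]
    ring
  have key := norm_integral_le_of_norm_le (μ := volume.restrict (Ioi (0 : ℝ))) (h1.add h2)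
    ((ae_restrict_iff' measurableSet_Ioi).2 (ae_of_all _ fun u hu => by
      rw [Real.norm_eq_abs]; exact hpw u hu))
  rw [hFval, Real.norm_eq_abs] at key
  refine key.trans (le_of_eq ?_)
  rw [integral_add' h1 h2, integral_evenPoly, integral_W_pair s hs1]

/-- **Equation 0 with error** (`E[W′] = 0`):
`|R I₁ + c I₂| ≤ θZ + (C₃/2)(l I₂ + I₄/l) + (K/2)(3l I₂ + 5 I₄/l) + (KR/2)(l I₄ + I₆/l) + Kc I₆`. -/
theorem sys0 (s : ℕ) (hs : 4 * 10 ^ 18 ≤ s) {A R c C l : ℝ} (hA : A = 4 * π * exp (4 * xiMode (s : ℝ)))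
    (hR : R = 4 * A + s / xiMode (s : ℝ) ^ 2) (hc : c = 8 * A - s / xiMode (s : ℝ) ^ 3)
    (hC : C = 15 * A + 2 * s / xiMode (s : ℝ) ^ 4) (hl : 0 < l) :
    |R * (∫ u in Ioi 0, deBruijnPhi u * u ^ s * (u - xiMode (s : ℝ))) + c * xiAbsMoment s 2 (xiMode (s : ℝ))| ≤
      1 / 200 * xiMoment s + C / 2 * (l * xiAbsMoment s 2 (xiMode (s : ℝ)) + xiAbsMoment s 4 (xiMode (s : ℝ)) / l) +
        10 ^ 8 / 2 * (l * (3 * xiAbsMoment s 2 (xiMode (s : ℝ))) + 5 * xiAbsMoment s 4 (xiMode (s : ℝ)) / l) +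
        10 ^ 8 * R / 2 * (l * xiAbsMoment s 4 (xiMode (s : ℝ)) + xiAbsMoment s 6 (xiMode (s : ℝ)) / l) +
        10 ^ 8 * c * xiAbsMoment s 6 (xiMode (s : ℝ)) := by
  have hs1 : 1 ≤ s := le_trans (by norm_num) hs
  obtain ⟨hApos, _, _, hR0, hc0, _⟩ := consts_facts s hs hA hR hc
  set a := xiMode (s : ℝ) with ha_def
  have hC0 : 0 ≤ C := by rw [hC]; have := (mode_facts s hs).1; positivity
  have h := sys_of_pointwise s hs1 a R c 0 1 (1 / 200) (C * l / 2) (C / (2 * l) + 10 ^ 8 * R * l / 2)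
    (10 ^ 8 * R / (2 * l) + 10 ^ 8 * c) 0 0 (10 ^ 8 * l / 2) (10 ^ 8 / (2 * l)) (fun u hu => by
      obtain ⟨htw, hρ⟩ := pointwise_inputs s hs hA hR hc hu
      rw [← hC] at hρ
      have hp := pw0 (θ := 1 / 200) (l := l) hl (by norm_num) hR0.le hC0 htw hρ
      have hw : 0 < deBruijnPhi u * u ^ s := mul_pos (deBruijnPhi_pos_holds u) (pow_pos hu s)
      rw [abs_mul, abs_of_pos hw, pow_zero, one_mul]
      refine (mul_le_mul_of_nonneg_left hp hw.le).trans (le_of_eq ?_)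
      ring)
  simp only [Nat.cast_zero, zero_mul, zero_sub, zero_add, pow_one, Nat.reduceMul, Nat.reduceAdd, Nat.cast_one] at h
  have e2 : (∫ u in Ioi 0, deBruijnPhi u * u ^ s * (u - a) ^ 2) = xiAbsMoment s 2 a := by
    rw [show (2 : ℕ) = 2 * 1 from rfl]; exact (xiAbsMoment_even s 1 a).symm
  rw [e2, show -(R * ∫ u in Ioi 0, deBruijnPhi u * u ^ s * (u - a)) - c * xiAbsMoment s 2 a =
    -(R * (∫ u in Ioi 0, deBruijnPhi u * u ^ s * (u - a)) + c * xiAbsMoment s 2 a) by ring, abs_neg] at h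
  refine h.trans (le_of_eq ?_)
  norm_num
  ring

/-- **Equation 1 with error** (`E[tW′] = 1`):
`|Z − R I₂ − c I₃| ≤ (θ/2)(lZ + I₂/l) + C₃I₄ + 5K I₄ + KR I₆ + (Kc/2)(l I₆ + I₈/l)`. -/
theorem sys1 (s : ℕ) (hs : 4 * 10 ^ 18 ≤ s) {A R c C l : ℝ} (hA : A = 4 * π * exp (4 * xiMode (s : ℝ)))
    (hR : R = 4 * A + s / xiMode (s : ℝ) ^ 2) (hc : c = 8 * A - s / xiMode (s : ℝ) ^ 3)
    (hC : C = 15 * A + 2 * s / xiMode (s : ℝ) ^ 4) (hl : 0 < l) :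
    |xiMoment s - R * xiAbsMoment s 2 (xiMode (s : ℝ)) -
        c * (∫ u in Ioi 0, deBruijnPhi u * u ^ s * (u - xiMode (s : ℝ)) ^ 3)| ≤
      1 / 200 / 2 * (l * xiMoment s + xiAbsMoment s 2 (xiMode (s : ℝ)) / l) + C * xiAbsMoment s 4 (xiMode (s : ℝ)) +
        5 * 10 ^ 8 * xiAbsMoment s 4 (xiMode (s : ℝ)) + 10 ^ 8 * R * xiAbsMoment s 6 (xiMode (s : ℝ)) +
        10 ^ 8 * c / 2 * (l * xiAbsMoment s 6 (xiMode (s : ℝ)) + xiAbsMoment s 8 (xiMode (s : ℝ)) / l) := by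
  have hs1 : 1 ≤ s := le_trans (by norm_num) hs
  obtain ⟨hApos, _, _, hR0, hc0, _⟩ := consts_facts s hs hA hR hc
  set a := xiMode (s : ℝ) with ha_def
  have hC0 : 0 ≤ C := by rw [hC]; have := (mode_facts s hs).1; positivity
  have h := sys_of_pointwise s hs1 a R c 1 1 (1 / 200 * l / 2) (1 / 200 / (2 * l)) C (10 ^ 8 * R + 10 ^ 8 * c * l / 2)
    (10 ^ 8 * c / (2 * l)) 0 0 (10 ^ 8) (fun u hu => by
      obtain ⟨htw, hρ⟩ := pointwise_inputs s hs hA hR hc hu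
      rw [← hC] at hρ
      have hp := pw1 (θ := 1 / 200) (l := l) hl (by norm_num) (by norm_num) hc0.le htw hρ
      have hw : 0 < deBruijnPhi u * u ^ s := mul_pos (deBruijnPhi_pos_holds u) (pow_pos hu s)
      rw [abs_mul, abs_of_pos hw, pow_one]
      refine (mul_le_mul_of_nonneg_left hp hw.le).trans (le_of_eq ?_)
      ring)
  simp only [Nat.cast_one, one_mul, zero_mul, zero_add, add_zero, Nat.reduceAdd, Nat.sub_self,
    pow_zero, mul_one] at h
  have e2 : (∫ u in Ioi 0, deBruijnPhi u * u ^ s * (u - a) ^ 2) = xiAbsMoment s 2 a := by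
    rw [show (2 : ℕ) = 2 * 1 from rfl]; exact (xiAbsMoment_even s 1 a).symm
  have e0 : (∫ u in Ioi 0, deBruijnPhi u * u ^ s) = xiMoment s := rfl
  rw [e2, e0] at h
  refine h.trans (le_of_eq ?_)
  norm_num
  ring


end Summit.RiemannHypothesis.RiemannHypothesis.Theorems.JensenPolynomials.SkewFar

end
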